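import Summits.Ventures.HSemireg.PhaseTorusLawCoranks

/-!
# The E8 LAW on the phase torus `(μ₄)⁴` (corank-free): positive phases inside a coset of the even-weight code `E8` ⇒ `μ = 0`
# (HSemireg support file; phase-torus line, corank threshold, module 2 of 4)

Crux of record: `Summit.HodgeConjecture.HodgeConjecture.Theses.EightfoldBlochSeeds.BlochSeedDiscOne`
(= `HasHyperbolicBlochSeed 4 1`, item stmt-HodgeConjecture-18881; skeleton `Lines/birth.lean`, STUB R `stub_rung_pad4_seedAt`,
named technique = PAD-4 two-level ⊕-block design with a TWO-TERM line-bundle presentation).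
Nothing in this file proves HC, HC_AV, HC_CM, H2 or item 18881; census-neutral (no SAT∕UNSAT row is added or changed).

WHAT THIS FILE IS (tree copy of §5 of the crux workfile `Cruxes/BlochSeedDiscOne/PhaseTorusLawAllCoranks.lean` b3a30e3be1a62a1c, author
s4-prove-2 g0, director-hodge R19.171 block F1; statements verbatim over the tree's `e` calculus of `PhaseTorusLaw.lean` (the workfile's local `u4` is `e` by `rfl`); pen + stdlib numerics:
`Cruxes/BlochSeedDiscOne/PHASE-TORUS-ALLCORANK-s4p2.md` f9de3e256e8a2f46, certificates found by the exact orbit LP `py/symlp.py`):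
`E8 = {τ ∈ L : |τ| ≡ 0 (4)}` (`e8Set`, 8 phases; `L = evenSet` of `PhaseTorusLawCoranks`).  For a CLEAN real signed measure `ω`
(`KAdm k → moment ω k = 0`) with `μ = moment ω (1,1,1,1)`:
* `sum_eq_zero_of_clean` (`Σ ω = 0`), `sum_mul_re` ∕ `sum_mul_im` (`Σ ω·Re χ = Re μ`, `Σ ω·Im χ = Im μ`, `χ = χ₁₁₁₁ = i^{|τ|}`);
* **the coset identity** `sum_evenSet_mul_chi`: `Σ_{τ ∈ L} ω(τ)χ(τ) = (μ + μ̄)/16` (Poisson over the self-dual `L`, the 14 frequencies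
  `1111 + δ`, `δ ∈ L ∖ {0, 2222}` being clean), whence `sum_mul_ind_re`: `Σ ω·𝟙_L·Re χ = Re μ / 8`;
* **`e8Law_zero`** (base coset) from the four non-negative certificates vanishing on `E8`: `F₁ = 1 − Re χ` (`Re μ ≥ 0`),
  `F₂ = 1 + Re χ − 2·𝟙_L·Re χ` (`¾ Re μ ≤ 0`), `F₃± = 1 − Re χ ± Im χ` (`−Re μ ± Im μ ≤ 0`) ⇒ `μ = 0`;
* **`e8Law`** (every coset `E8 + c`, by translation `moment_translate`): a clean `ω` that is `≤ 0` off `E8 + c` has `μ = 0` —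
  NO cardinality hypothesis.
Everything here is PROVED (axioms `propext`, `Classical.choice`, `Quot.sound`; no `sorry`, no named fact, no instance, no notation).

WHAT IT IS NOT: a statement about sheaves, monads, a SOURCE or a SEED.  With the box-hosted law and the 8-set dichotomy (sequels
`PhaseTorusBoxHosting`, `PhaseTorusLawEight`) it gives the phase-torus law at corank `≤ 8`.
Tree filing: hsemireg-phasetorus-typer-1 g2.
-/

namespace Summit.Ventures.HSemireg.PhaseTorus

open Finset BigOperators

/-! ## The even-weight code `E8`, the coset identity, and the E8 law -/

/-- the even-weight code `E8 ⊆ L`: even phases with `|τ| ≡ 0 (mod 4)`. -/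
def e8Set : Finset PT := evenSet.filter fun τ => ∑ f, τ f = 0

/-- membership in `E8`. -/
theorem mem_e8Set {τ : PT} : τ ∈ e8Set ↔ τ ∈ evenSet ∧ ∑ f, τ f = 0 := Finset.mem_filter


/-- pairing a measure that is `≤ 0` off `A` against a non-negative test function vanishing on `A` gives `≤ 0`. -/
theorem pairing_nonpos (ω F : PT → ℝ) (A : Finset PT) (hω : ∀ τ, τ ∉ A → ω τ ≤ 0) (hF : ∀ τ, 0 ≤ F τ)
    (hFA : ∀ τ, τ ∈ A → F τ = 0) : ∑ τ, ω τ * F τ ≤ 0 := by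
  refine Finset.sum_nonpos fun τ _ => ?_
  by_cases h : τ ∈ A
  · rw [hFA τ h, mul_zero]
  · exact mul_nonpos_of_nonpos_of_nonneg (hω τ h) (hF τ)

/-- `χ_0 = 1`. -/
theorem chi_zero_left (τ : PT) : chi 0 τ = 1 := by
  rw [chi_eq_e]; simp [e_zero]

/-- `χ₁₁₁₁(τ) = i^{|τ|}`. -/
theorem chi_one_left (τ : PT) : chi (fun _ => 1) τ = e (∑ f, τ f) := by
  rw [chi_eq_e]; exact congrArg e (Finset.sum_congr rfl fun f _ => one_mul _)

/-- `Σ ω = 0` for a clean `ω` (the row `k = 0`). -/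
theorem sum_eq_zero_of_clean (ω : PT → ℝ) (hK : ∀ k, KAdm k → moment ω k = 0) : ∑ τ, ω τ = 0 := by
  have h := hK 0 ⟨fun f => by show (0 : ZMod 4) ≠ 2; decide, fun h => absurd (congr_fun h 0) (by decide),
    fun h => absurd (congr_fun h 0) (by decide)⟩
  unfold moment at h
  simp_rw [chi_zero_left, mul_one] at h
  exact_mod_cast h

/-- `Σ ω·Re χ = Re μ`. -/
theorem sum_mul_re (ω : PT → ℝ) : ∑ τ, ω τ * (e (∑ f, τ f)).re = (moment ω (fun _ => 1)).re := by
  unfold moment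
  rw [Complex.re_sum]
  exact Finset.sum_congr rfl fun τ _ => by rw [chi_one_left, Complex.re_ofReal_mul]

/-- `Σ ω·Im χ = Im μ`. -/
theorem sum_mul_im (ω : PT → ℝ) : ∑ τ, ω τ * (e (∑ f, τ f)).im = (moment ω (fun _ => 1)).im := by
  unfold moment
  rw [Complex.im_sum]
  exact Finset.sum_congr rfl fun τ _ => by rw [chi_one_left, Complex.im_ofReal_mul]

/-- `χ_k(τ) = χ_τ(k)`. -/
theorem chi_comm (k τ : PT) : chi k τ = chi τ k := by
  rw [chi_eq_e, chi_eq_e]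
  exact congrArg e (Finset.sum_congr rfl fun f _ => mul_comm _ _)

/-- `16·𝟙_L(τ) = Σ_{δ ∈ L} χ_δ(τ)` (Poisson over the self-dual `L`). -/
theorem indicator_evenSet (τ : PT) : ∑ δ ∈ evenSet, chi δ τ = if τ ∈ evenSet then 16 else 0 := by
  rw [Finset.sum_congr rfl fun δ _ => chi_comm δ τ, sum_chi_evenSet]

/-- `2222 ∈ L` and `2222 ≠ 0`. -/
theorem two_facts : ((fun _ => (2 : ZMod 4)) : PT) ∈ evenSet ∧ ((fun _ => (2 : ZMod 4)) : PT) ≠ 0 := by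
  refine ⟨mem_evenSet.2 fun _ => Or.inr rfl, fun h => absurd (congr_fun h 0) (by decide)⟩

/-- for `δ ∈ L ∖ {0, 2222}` the frequency `1111 + δ` is clean. -/
theorem kadm_one_add {δ : PT} (hδ : δ ∈ evenSet) (h0 : δ ≠ 0) (h2 : δ ≠ fun _ => 2) :
    KAdm ((fun _ => (1 : ZMod 4)) + δ) := by
  rw [mem_evenSet] at hδ
  refine ⟨fun f => ?_, fun h => h0 ?_, fun h => h2 ?_⟩
  · rcases hδ f with e | e <;> simp [e] <;> decide
  · funext f; have := congr_fun h f; simp at this; exact this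
  · funext f
    have hf := congr_fun h f
    simp only [Pi.add_apply] at hf
    have key : ∀ x : ZMod 4, 1 + x = 3 → x = 2 := by decide
    exact key _ hf

/-- **the coset identity**: `Σ_{τ ∈ L} ω(τ)χ₁₁₁₁(τ) = (μ + μ̄)/16` for a clean `ω`. -/
theorem sum_evenSet_mul_chi (ω : PT → ℝ) (hK : ∀ k, KAdm k → moment ω k = 0) :
    ∑ τ ∈ evenSet, (ω τ : ℂ) * chi (fun _ => 1) τ =
      (moment ω (fun _ => 1) + (starRingEnd ℂ) (moment ω (fun _ => 1))) / 16 := by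
  have h16 : (16 : ℂ) * ∑ τ ∈ evenSet, (ω τ : ℂ) * chi (fun _ => 1) τ =
      ∑ δ ∈ evenSet, moment ω ((fun _ => (1 : ZMod 4)) + δ) := by
    calc (16 : ℂ) * ∑ τ ∈ evenSet, (ω τ : ℂ) * chi (fun _ => 1) τ
        = ∑ τ, (ω τ : ℂ) * chi (fun _ => 1) τ * ∑ δ ∈ evenSet, chi δ τ := by
          rw [Finset.mul_sum, ← Finset.sum_filter_add_sum_filter_not Finset.univ (· ∈ evenSet)]
          rw [Finset.filter_mem_eq_inter, Finset.univ_inter]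
          have hz : ∑ τ ∈ Finset.univ.filter (fun τ => ¬ τ ∈ evenSet),
              (ω τ : ℂ) * chi (fun _ => 1) τ * ∑ δ ∈ evenSet, chi δ τ = 0 :=
            Finset.sum_eq_zero fun τ hτ => by
              rw [indicator_evenSet, if_neg (Finset.mem_filter.1 hτ).2, mul_zero]
          rw [hz, add_zero]
          refine Finset.sum_congr rfl fun τ hτ => ?_
          rw [indicator_evenSet, if_pos hτ]; ring
      _ = ∑ δ ∈ evenSet, ∑ τ, (ω τ : ℂ) * chi ((fun _ => 1) + δ) τ := by
          rw [Finset.sum_comm]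
          refine Finset.sum_congr rfl fun τ _ => ?_
          rw [Finset.mul_sum]
          refine Finset.sum_congr rfl fun δ _ => ?_
          rw [mul_assoc, chi_mul_chi]
      _ = ∑ δ ∈ evenSet, moment ω ((fun _ => (1 : ZMod 4)) + δ) := rfl
  have hsplit : ∑ δ ∈ evenSet, moment ω ((fun _ => (1 : ZMod 4)) + δ) =
      moment ω (fun _ => 1) + (starRingEnd ℂ) (moment ω (fun _ => 1)) := by
    rw [← Finset.add_sum_erase _ _ (mem_evenSet.2 fun _ => Or.inl rfl : (0 : PT) ∈ evenSet),
      ← Finset.add_sum_erase _ _ (Finset.mem_erase.2 ⟨two_facts.2, two_facts.1⟩)]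
    have h12 : ((fun _ => (1 : ZMod 4)) + (fun _ => (2 : ZMod 4)) : PT) = fun _ => 3 := by
      funext f; show (1 : ZMod 4) + 2 = 3; decide
    rw [Finset.sum_eq_zero fun δ hδ => ?_]
    · rw [add_zero, add_zero, h12, ← moment_three_eq_conj_moment_one]
    · obtain ⟨h2, h0', hL⟩ : δ ≠ (fun _ => 2) ∧ δ ≠ 0 ∧ δ ∈ evenSet := by
        simpa [Finset.mem_erase, and_assoc] using hδ
      exact hK _ (kadm_one_add hL h0' h2)
  have h16' : (16 : ℂ) ≠ 0 := by norm_num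
  rw [eq_div_iff h16', mul_comm, h16, hsplit]

/-- `Σ_τ ω·𝟙_L·Re χ = Re μ / 8`. -/
theorem sum_mul_ind_re (ω : PT → ℝ) (hK : ∀ k, KAdm k → moment ω k = 0) :
    ∑ τ, ω τ * ((if τ ∈ evenSet then 1 else 0) * (e (∑ f, τ f)).re) = (moment ω (fun _ => 1)).re / 8 := by
  have h := congrArg Complex.re (sum_evenSet_mul_chi ω hK)
  rw [Complex.re_sum] at h
  simp only [Complex.div_ofNat_re, Complex.add_re, Complex.conj_re] at h
  have hA : ∑ τ, ω τ * ((if τ ∈ evenSet then 1 else 0) * (e (∑ f, τ f)).re) =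
      ∑ τ ∈ evenSet, ω τ * (e (∑ f, τ f)).re := by
    rw [← Finset.univ_inter evenSet, ← Finset.sum_ite_mem, Finset.univ_inter]
    refine Finset.sum_congr rfl fun τ _ => ?_
    split_ifs <;> simp
  have hB : ∑ τ ∈ evenSet, ω τ * (e (∑ f, τ f)).re = ∑ τ ∈ evenSet, ((ω τ : ℂ) * chi (fun _ => 1) τ).re :=
    Finset.sum_congr rfl fun τ _ => by rw [chi_one_left, Complex.re_ofReal_mul]
  rw [hA, hB, h]
  ring

/-- `Re(i^x) ≤ 1`. -/
theorem re_e_le (x : ZMod 4) : (e x).re ≤ 1 := by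
  rcases e_cases x with h | h | h | h <;> rw [h] <;> simp

/-- `−1 ≤ Re(i^x)`. -/
theorem neg_one_le_re_e (x : ZMod 4) : -1 ≤ (e x).re := by
  rcases e_cases x with h | h | h | h <;> rw [h] <;> simp

/-- the certificates `1 − Re(i^x) ± Im(i^x)` are non-negative. -/
theorem cert3_nonneg (x : ZMod 4) : 0 ≤ 1 - (e x).re + (e x).im ∧ 0 ≤ 1 - (e x).re - (e x).im := by
  rcases e_cases x with h | h | h | h <;> rw [h] <;> simp

/-- **E8 LAW (base coset)**: a clean `ω` that is `≤ 0` off `E8` has `μ = 0`. -/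
theorem e8Law_zero (ω : PT → ℝ) (hω : ∀ τ, τ ∉ e8Set → ω τ ≤ 0) (hK : ∀ k, KAdm k → moment ω k = 0) :
    moment ω (fun _ => 1) = 0 := by
  set m := moment ω (fun _ => 1) with hm
  have h0 := sum_eq_zero_of_clean ω hK
  have hre := sum_mul_re ω
  have him := sum_mul_im ω
  have hind := sum_mul_ind_re ω hK
  -- values of χ on E8: Re χ = 1, Im χ = 0
  have onE8 : ∀ τ, τ ∈ e8Set → (e (∑ f, τ f)).re = 1 ∧ (e (∑ f, τ f)).im = 0 ∧ τ ∈ evenSet := fun τ hτ => by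
    obtain ⟨hL, hs⟩ := mem_e8Set.1 hτ
    rw [hs, e_zero]; simp [hL]
  -- F₁ = 1 − Re χ  ⇒  Re m ≥ 0
  have P1 := pairing_nonpos ω (fun τ => 1 - (e (∑ f, τ f)).re) e8Set hω
    (fun τ => by linarith [re_e_le (∑ f, τ f)]) (fun τ hτ => by simp [(onE8 τ hτ).1])
  -- F₂ = 1 + Re χ − 2·𝟙_L·Re χ  ⇒  Re m ≤ 0
  have P2 := pairing_nonpos ω
    (fun τ => 1 + (e (∑ f, τ f)).re - 2 * ((if τ ∈ evenSet then 1 else 0) * (e (∑ f, τ f)).re)) e8Set hω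
    (fun τ => by
      by_cases h : τ ∈ evenSet
      · rw [if_pos h]; linarith [re_e_le (∑ f, τ f)]
      · rw [if_neg h]; linarith [neg_one_le_re_e (∑ f, τ f)])
    (fun τ hτ => by simp [(onE8 τ hτ).1, (onE8 τ hτ).2.2]; norm_num)
  -- F₃± = 1 − Re χ ± Im χ  ⇒  −Re m ± Im m ≤ 0
  have P3 := pairing_nonpos ω (fun τ => 1 - (e (∑ f, τ f)).re + (e (∑ f, τ f)).im) e8Set hω
    (fun τ => (cert3_nonneg _).1) (fun τ hτ => by simp [(onE8 τ hτ).1, (onE8 τ hτ).2.1])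
  have P4 := pairing_nonpos ω (fun τ => 1 - (e (∑ f, τ f)).re - (e (∑ f, τ f)).im) e8Set hω
    (fun τ => (cert3_nonneg _).2) (fun τ hτ => by simp [(onE8 τ hτ).1, (onE8 τ hτ).2.1])
  have hind2 : ∑ τ, ω τ * (2 * ((if τ ∈ evenSet then 1 else 0) * (e (∑ f, τ f)).re)) = 2 * (m.re / 8) := by
    rw [← hind, Finset.mul_sum]
    exact Finset.sum_congr rfl fun τ _ => by ring
  simp only [mul_sub, mul_add, mul_one, Finset.sum_sub_distrib, Finset.sum_add_distrib, h0, hre, him, hind2] at P1 P2 P3 P4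
  apply Complex.ext
  · simp; linarith
  · simp; linarith

/-- `χ_k` is additive in the phase: `χ_k(τ + c) = χ_k(τ)·χ_k(c)`. -/
theorem chi_add_right (k τ c : PT) : chi k (τ + c) = chi k τ * chi k c := by
  rw [chi_eq_e, chi_eq_e, chi_eq_e, ← e_add]
  congr 1
  rw [← Finset.sum_add_distrib]
  exact Finset.sum_congr rfl fun f _ => by rw [Pi.add_apply, mul_add]

/-- characters do not vanish. -/
theorem chi_ne_zero (k τ : PT) : chi k τ ≠ 0 := by
  rw [chi_eq_e]; unfold e
  exact pow_ne_zero _ Complex.I_ne_zero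

/-- moments of a translate: `Σ_τ ω(τ + c) χ_k(τ) = χ_k(−c)·ω̂(k)`. -/
theorem moment_translate (ω : PT → ℝ) (c k : PT) :
    moment (fun τ => ω (τ + c)) k = chi k (-c) * moment ω k := by
  unfold moment
  rw [Finset.mul_sum]
  refine Fintype.sum_equiv (Equiv.addRight c) _ _ fun τ => ?_
  simp only [Equiv.coe_addRight]
  rw [show chi k τ = chi k (τ + c + -c) from by rw [add_neg_cancel_right], chi_add_right k (τ + c) (-c)]
  ring

/-- **E8 LAW (every coset; corank-free)**: a clean `ω` that is `≤ 0` off a coset `E8 + c` has `μ = 0`. -/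
theorem e8Law (ω : PT → ℝ) (c : PT) (hω : ∀ τ, τ ∉ e8Set.image (· + c) → ω τ ≤ 0)
    (hK : ∀ k, KAdm k → moment ω k = 0) : moment ω (fun _ => 1) = 0 := by
  have h := e8Law_zero (fun τ => ω (τ + c))
    (fun τ hτ => hω _ fun him => hτ (by
      obtain ⟨σ, hσ, e⟩ := Finset.mem_image.1 him
      rwa [← add_right_cancel e]))
    (fun k hk => by rw [moment_translate, hK k hk, mul_zero])
  rw [moment_translate] at h
  exact (mul_eq_zero.1 h).resolve_left (chi_ne_zero _ _)

/-! ## §6 Corank 8 from the dichotomy -/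

end Summit.Ventures.HSemireg.PhaseTorus
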